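import Mathlib
import HarnessLib
import Summits.HubbardSuperconductivity.HubbardSuperconductivity.Theorems.KLProgrammeH10TwoPointLimitFramePerturbation
import Summits.HubbardSuperconductivity.HubbardSuperconductivity.Theorems.KLProgrammeKLRegimeCountertermLatticeAngleNet
import Summits.HubbardSuperconductivity.HubbardSuperconductivity.Theorems.KLProgrammeH10TwoPointLimitRelativeSectorCount
import Literature.MathematicalPhysics.QuantumLattice.SSectorNesting

/-!
# Route `KLProgramme` — crux K1 `H10TwoPointLimit` (stmt-HubbardSuperconductivity-19938) / K3's ENGINE child:
# the TORUS ↔ CONTINUUM dictionary for sector counting on admissible frames — torus momenta as centred real momenta, the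
# renormalised band `nambuXiCT` as the frame level function, and the SUPPORT of the engine's sector multipliers
# (`klIsoFamily` / `klAnisoFamily`) in the vocabulary of the lineage's counting rows (`|k i| ≤ π`, `e_K`-shells, `sectorIndex`)

Cell `gate-hubbard-kl`, seat p4 (C5a lead), g5.  The engine's constraint sets `bgmSectorSet L M (klIsoFamily L M β μ K klE0 n) m`
(`…SectorisedLegKernelsDefs`, BGM 2006 (2.73)) quantify over TORUS momenta `k : TorusSite 2 L` in the supports of smooth sector
multipliers, while the counting rows of `KLProgrammeH10TwoPointLimitFrameSectorCount.lean` quantify over REAL momenta of the closed square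
with sharp `sectorIndex` labels and `e_K`-shells `|frameLevel μ K| ≤ η`.  This file is the dictionary between the two, nothing else:

* §1 the centred representative `torusCentredMomentum L k ∈ (-π, π]²` (`abs_torusCentredMomentum_le_pi`), `= latticeMomentum + 2πm`
  (`exists_torusCentredMomentum_eq_add`), the frame correction and the renormalised band read through it:
  `frameShift K (toLp (centred k)) = -K(latticeMomentum k)`, **`nambuXiCT L μ K k = frameLevel μ K (toLp (torusCentredMomentum L k))`**;
  the polar angle `momentumAngle L k = arg ⟨c 0, c 1⟩`.
* §2 support of the Gallavotti–Nicolò cutoff: `gnScaleCutoff 4 e₀ (-n) (√(ω₀² + e²)) ≠ 0 ⇒ |e|, |ω₀| < e₀·4^{-n}`; hence a leg in the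
  support of the isotropic multiplier `klIsoFamily … n ω` (resp. anisotropic `klAnisoFamily … n ω`) has `|e_K(k)| < e₀ 4^{-n}`
  (`= klScale e₀ n`), Matsubara frequency below the scale, and polar angle in the support of `sectorWeightCirc (2n) ω`
  (resp. `sectorWeightCirc n ω`).
* §3 support of the smooth angular partition ⇒ sharp index: `sectorWeightCirc n ω θ ≠ 0 ⇒ sectorIndex n θ ≡ ω + d (mod sectorCount n)`
  with `|d| ≤ 1` (`sectorIndex_near_of_sectorWeightCirc_ne_zero`) — each smooth sector meets at most three sharp ones.

Everything is PROVED; no definitions, no named facts.  References: BGM 2006 §2.5 (2.45)–(2.48), (2.57), §2.8 (2.73)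
[cite: BenfattoGiulianiMastropietro2006]; HOME/prover-p4/PORT-NOTE.md §7(c).
-/

noncomputable section

namespace Summit.HubbardSuperconductivity.HubbardSuperconductivity.Theorems.PerturbedFermiCurve

set_option linter.dupNamespace false -- summit = problem name (single-conjunct summit), D-0017

open Classical
open Real Set Finset
open Literature.MathematicalPhysics.QuantumLattice Literature.MathematicalPhysics.QuantumLattice.BandSectorCounting
open Literature.Probability.LatticeModels
open Summit.HubbardSuperconductivity.HubbardSuperconductivity.Theorems.DispersionFlow
open Summit.HubbardSuperconductivity.HubbardSuperconductivity.Theorems.KLRegimeSplit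
open Summit.HubbardSuperconductivity.HubbardSuperconductivity.Theorems.KLProgrammeLegKernels

/-! ## §1 Torus momenta as centred real momenta; the renormalised band as the frame level function -/

section Torus

variable (L : ℕ)

/-- The centred representative lies in the closed square: `|c_i| ≤ π`. [folklore] -/
theorem abs_torusCentredMomentum_le_pi (k : TorusSite 2 L) (i : Fin 2) : |torusCentredMomentum L k i| ≤ π := by
  have h := toIocMod_mem_Ioc Real.two_pi_pos (-Real.pi) (latticeMomentum L k i)
  rw [abs_le]
  unfold torusCentredMomentum
  constructor <;> linarith [h.1, h.2]

/-- The centred representative differs from the lattice momentum by a reciprocal vector: `c = p + 2πm`. [folklore] -/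
theorem exists_torusCentredMomentum_eq_add (k : TorusSite 2 L) :
    ∃ m : Fin 2 → ℤ, torusCentredMomentum L k = fun i => latticeMomentum L k i + 2 * π * m i := by
  refine ⟨fun i => -toIocDiv Real.two_pi_pos (-Real.pi) (latticeMomentum L k i), funext fun i => ?_⟩
  have h := self_sub_toIocMod Real.two_pi_pos (-Real.pi) (latticeMomentum L k i)
  rw [zsmul_eq_mul] at h
  unfold torusCentredMomentum
  push_cast
  linarith

/-- **The frame correction at a torus momentum**: `δ_K(c(k)) = -K(p(k))` (periodicity of the frame). -/
theorem frameShift_toLp_torusCentredMomentum (K : TrigPolyC4v) (k : TorusSite 2 L) :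
    frameShift K (WithLp.toLp 2 (torusCentredMomentum L k)) = -K.eval (latticeMomentum L k) := by
  obtain ⟨m, hm⟩ := exists_torusCentredMomentum_eq_add L k
  rw [hm, frameShift_toLp_periodic, frameShift_toLp]

/-- **The renormalised band IS the frame level function at the centred momentum**:
`nambuXiCT L μ K k = frameLevel μ K (toLp (torusCentredMomentum L k))`. -/
theorem nambuXiCT_eq_frameLevel (μ : ℝ) (K : TrigPolyC4v) (k : TorusSite 2 L) :
    nambuXiCT L μ K k = frameLevel μ K (WithLp.toLp 2 (torusCentredMomentum L k)) := by
  rw [frameLevel_toLp, frameShift_toLp_torusCentredMomentum, sqDispersion_eq_eps2, ← torusBand_eq_eps2_torusCentredMomentum]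
  unfold nambuXiCT
  ring

/-- **The `e_K`-shell in both vocabularies**: `|nambuXiCT L μ K k| ≤ η ↔ |frameLevel μ K (toLp c(k))| ≤ η`. -/
theorem abs_nambuXiCT_le_iff (μ : ℝ) (K : TrigPolyC4v) (k : TorusSite 2 L) (η : ℝ) :
    |nambuXiCT L μ K k| ≤ η ↔ |frameLevel μ K (WithLp.toLp 2 (torusCentredMomentum L k))| ≤ η := by
  rw [nambuXiCT_eq_frameLevel]

/-- **The polar angle of a torus momentum** is the argument of its centred representative read as a complex number. -/
theorem momentumAngle_eq_arg (k : TorusSite 2 L) :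
    momentumAngle L k = Complex.arg (⟨torusCentredMomentum L k 0, torusCentredMomentum L k 1⟩ : ℂ) := by
  rw [momentumAngle, polarAngle, RelativeSectorCount.momToComplex_eq_mk]

end Torus

/-! ## §2 Support of the scale cutoff and of the engine's sector multipliers -/

/-- **Support of the Gallavotti–Nicolò scale cutoff**: `χ_{≤ h}(t) ≠ 0 ⇒ t < e₀ γ^h` (`γ = 4`, `h = -n`). [folklore] -/
theorem lt_of_gnScaleCutoff_ne_zero {e₀ : ℝ} (he : 0 < e₀) {n : ℕ} {t : ℝ}
    (h : gnScaleCutoff 4 e₀ (-(n : ℤ)) t ≠ 0) : t < e₀ * (4 : ℝ) ^ (-(n : ℤ)) := by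
  by_contra hle
  exact h (gnScaleCutoff_eq_zero (by norm_num) he (not_lt.mp hle))

/-- `e₀ 4^{-n} = klScale e₀ n`. [folklore] -/
theorem e0_mul_zpow_neg_eq_klScale (e₀ : ℝ) (n : ℕ) : e₀ * (4 : ℝ) ^ (-(n : ℤ)) = klScale e₀ n := by
  rw [klScale, zpow_neg, zpow_natCast]

/-- **A frequency–momentum in the support of `χ_{≤ h}(√(ω₀² + e²))` has `|e| < e₀ 4^{-n}` and `|ω₀| < e₀ 4^{-n}`.** [folklore] -/
theorem abs_lt_of_gnScaleCutoff_sqrt_ne_zero {e₀ : ℝ} (he : 0 < e₀) {n : ℕ} {ω₀ e : ℝ}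
    (h : gnScaleCutoff 4 e₀ (-(n : ℤ)) (Real.sqrt (ω₀ ^ 2 + e ^ 2)) ≠ 0) :
    |e| < klScale e₀ n ∧ |ω₀| < klScale e₀ n := by
  have ht := lt_of_gnScaleCutoff_ne_zero he h
  rw [e0_mul_zpow_neg_eq_klScale] at ht
  have h1 : |e| ≤ Real.sqrt (ω₀ ^ 2 + e ^ 2) := by
    rw [← Real.sqrt_sq_eq_abs]
    exact Real.sqrt_le_sqrt (by nlinarith)
  have h2 : |ω₀| ≤ Real.sqrt (ω₀ ^ 2 + e ^ 2) := by
    rw [← Real.sqrt_sq_eq_abs]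
    exact Real.sqrt_le_sqrt (by nlinarith)
  exact ⟨h1.trans_lt ht, h2.trans_lt ht⟩

section Support

variable (L M : ℕ)

/-- **Support of the ISOTROPIC multiplier** `klIsoFamily L M β μ K e₀ n ω` (`e₀ > 0`): a frequency–momentum `k` carrying it has its
renormalised band in the open shell `|e_K(k⃗)| < e₀ 4^{-n}`, its Matsubara frequency below the scale, and its polar angle in the support of
the smooth angular sector `sectorWeightCirc (2n) ω`. [cite: BenfattoGiulianiMastropietro2006, §2.5 (2.57)] -/
theorem support_klIsoFamily {e₀ : ℝ} (he : 0 < e₀) (β μ : ℝ) (K : TrigPolyC4v) (n : ℕ) (ω : Fin (sectorCount (2 * n)))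
    (k : FreqMomentum L M) (h : klIsoFamily L M β μ K e₀ n ω k ≠ 0) :
    |nambuXiCT L μ K k.2| < klScale e₀ n ∧ |matsubaraFreq β M k.1| < klScale e₀ n ∧
      sectorWeightCirc (2 * n) ω (momentumAngle L k.2) ≠ 0 := by
  unfold klIsoFamily klIsoMultiplier at h
  have h' : gnScaleCutoff 4 e₀ (-(n : ℤ)) (Real.sqrt (matsubaraFreq β M k.1 ^ 2 + nambuXiCT L μ K k.2 ^ 2)) *
      sectorWeightCirc (2 * n) ω (momentumAngle L k.2) ≠ 0 := fun h0 => h (by rw [h0]; simp)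
  obtain ⟨hg, hs⟩ := mul_ne_zero_iff.mp h'
  obtain ⟨he', hω⟩ := abs_lt_of_gnScaleCutoff_sqrt_ne_zero he hg
  exact ⟨he', hω, hs⟩

/-- **Support of the ANISOTROPIC multiplier** `klAnisoFamily L M β μ K e₀ n ω` (= the tree's `bgmMultiplier` on `e_K`): shell
`|e_K(k⃗)| < e₀ 4^{-n}`, frequency below the scale, polar angle in the support of `sectorWeightCirc n ω`.
[cite: BenfattoGiulianiMastropietro2006, §2.5 (2.45)–(2.48)] -/
theorem support_klAnisoFamily {e₀ : ℝ} (he : 0 < e₀) (β μ : ℝ) (K : TrigPolyC4v) (n : ℕ) (ω : Fin (sectorCount n))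
    (k : FreqMomentum L M) (h : klAnisoFamily L M β μ K e₀ n ω k ≠ 0) :
    |nambuXiCT L μ K k.2| < klScale e₀ n ∧ |matsubaraFreq β M k.1| < klScale e₀ n ∧
      sectorWeightCirc n ω (momentumAngle L k.2) ≠ 0 := by
  unfold klAnisoFamily bgmMultiplier at h
  have h' : gnScaleCutoff 4 e₀ (-(n : ℤ)) (Real.sqrt (matsubaraFreq β M k.1 ^ 2 + nambuXiCT L μ K k.2 ^ 2)) *
      sectorWeightCirc n ω (momentumAngle L k.2) ≠ 0 := fun h0 => h (by rw [h0]; simp)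
  obtain ⟨hg, hs⟩ := mul_ne_zero_iff.mp h'
  obtain ⟨he', hω⟩ := abs_lt_of_gnScaleCutoff_sqrt_ne_zero he hg
  exact ⟨he', hω, hs⟩

/-- **The engine's isotropic support in the counting rows' vocabulary**: a torus momentum `k⃗` carrying `klIsoFamily … n ω` has a centred
representative `c ∈ [-π, π]²` with `|frameLevel μ K (toLp c)| < klScale e₀ n` and `sectorWeightCirc (2n) ω (arg ⟨c 0, c 1⟩) ≠ 0`. -/
theorem support_klIsoFamily_centred {e₀ : ℝ} (he : 0 < e₀) (β μ : ℝ) (K : TrigPolyC4v) (n : ℕ)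
    (ω : Fin (sectorCount (2 * n))) (k : FreqMomentum L M) (h : klIsoFamily L M β μ K e₀ n ω k ≠ 0) :
    (∀ i, |torusCentredMomentum L k.2 i| ≤ π) ∧
      |frameLevel μ K (WithLp.toLp 2 (torusCentredMomentum L k.2))| < klScale e₀ n ∧
      sectorWeightCirc (2 * n) ω
        (Complex.arg (⟨torusCentredMomentum L k.2 0, torusCentredMomentum L k.2 1⟩ : ℂ)) ≠ 0 := by
  obtain ⟨h1, -, h3⟩ := support_klIsoFamily L M he β μ K n ω k h
  rw [nambuXiCT_eq_frameLevel] at h1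
  rw [momentumAngle_eq_arg] at h3
  exact ⟨abs_torusCentredMomentum_le_pi L k.2, h1, h3⟩

end Support

/-! ## §3 Support of the smooth angular partition ⇒ sharp sector index within one -/

/-- **Support ⇒ sharp index within one (mod the number of sectors)**: if `ζ̃_{n,ω}(θ) ≠ 0` then
`sectorIndex n θ ≡ ω + d (mod sectorCount n)` for some `d ∈ {-1, 0, 1}` — a smooth sector meets at most the three sharp sectors
`ω − 1, ω, ω + 1`. [cite: BenfattoGiulianiMastropietro2006, §2.5 (2.45)] -/
theorem sectorIndex_near_of_sectorWeightCirc_ne_zero {n : ℕ} {ω : ℤ} {θ : ℝ} (h : sectorWeightCirc n ω θ ≠ 0) :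
    ∃ d : ℤ, |d| ≤ 1 ∧ (sectorCount n : ℤ) ∣ ((sectorIndex n θ : ℤ) - ω - d) := by
  obtain ⟨k, hk⟩ := exists_abs_lt_of_sectorWeightCirc_ne_zero h
  obtain ⟨m, hm⟩ := exists_angleRep_eq_add θ
  have hw := sectorWidth_pos n
  have hN := sectorCount_mul_sectorWidth n
  have harc := mem_sectorArc_sectorIndex n θ
  set s : ℕ := sectorIndex n θ with hs
  set w := sectorWidth n with hwdef
  set N : ℕ := sectorCount n with hNdef
  -- `angleRep θ = θ + 2πm`, and `2π = N w`
  have hrep : angleRep θ - ((ω : ℝ) + 1 / 2) * w - (N : ℝ) * w * ((k : ℝ) + m) =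
      θ - ((ω : ℝ) + 1 / 2) * w - 2 * π * k := by
    rw [hm, hN]; ring
  have hk' : |angleRep θ - ((ω : ℝ) + 1 / 2) * w - (N : ℝ) * w * ((k : ℝ) + m)| < 3 * w / 4 := by
    rw [hrep]; exact hk
  -- ω' := ω + (k + m) N
  set ω' : ℤ := ω + (k + m) * N with hω'
  have hlo : ((ω' : ℝ) - 1 / 4) * w < angleRep θ := by
    have := (abs_lt.mp hk').1
    have e : (ω' : ℝ) = ω + ((k : ℝ) + m) * N := by rw [hω']; push_cast; ring
    rw [e]; nlinarith
  have hhi : angleRep θ < ((ω' : ℝ) + 5 / 4) * w := by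
    have := (abs_lt.mp hk').2
    have e : (ω' : ℝ) = ω + ((k : ℝ) + m) * N := by rw [hω']; push_cast; ring
    rw [e]; nlinarith
  -- `s w ≤ angleRep θ < (s+1) w`
  have h1 : (s : ℝ) * w ≤ angleRep θ := harc.1
  have h2 : angleRep θ < ((s : ℝ) + 1) * w := harc.2
  -- hence `ω' - 1 ≤ s ≤ ω' + 1`
  have h3 : ((s : ℤ) : ℝ) < (ω' : ℝ) + 5 / 4 := by
    have : (s : ℝ) * w < ((ω' : ℝ) + 5 / 4) * w := lt_of_le_of_lt h1 hhi
    have := lt_of_mul_lt_mul_right this hw.le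
    exact_mod_cast this
  have h4 : (ω' : ℝ) - 1 / 4 < ((s : ℤ) : ℝ) + 1 := by
    have : ((ω' : ℝ) - 1 / 4) * w < ((s : ℝ) + 1) * w := hlo.trans h2
    have := lt_of_mul_lt_mul_right this hw.le
    exact_mod_cast this
  have h5 : (s : ℤ) ≤ ω' + 1 := by
    have : ((s : ℤ) : ℝ) < (ω' : ℝ) + 2 := by linarith
    have : (s : ℤ) < ω' + 2 := by exact_mod_cast this
    omega
  have h6 : ω' - 1 ≤ (s : ℤ) := by
    have : (ω' : ℝ) - 2 < ((s : ℤ) : ℝ) := by linarith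
    have : ω' - 2 < (s : ℤ) := by exact_mod_cast this
    omega
  refine ⟨(s : ℤ) - ω', ?_, ?_⟩
  · rw [abs_le]; constructor <;> omega
  · refine ⟨k + m, ?_⟩
    rw [hω']; ring

/-- **At most three smooth sectors see a given direction**: the labels `ω < sectorCount n` with `ζ̃_{n,ω}(θ) ≠ 0` all satisfy
`ω ≡ sectorIndex n θ + d (mod sectorCount n)`, `|d| ≤ 1`; as a cardinality statement, that label set has at most `3` elements. -/
theorem card_filter_sectorWeightCirc_ne_zero_le (n : ℕ) (θ : ℝ) :
    ((Finset.univ : Finset (Fin (sectorCount n))).filter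
        (fun ω : Fin (sectorCount n) => sectorWeightCirc n ((ω : ℕ) : ℤ) θ ≠ 0)).card ≤ 3 := by
  set N : ℕ := sectorCount n with hNdef
  have hNpos : 0 < N := sectorCount_pos n
  set s : ℕ := sectorIndex n θ with hs
  -- the three candidate labels, as residues mod N
  set f : Fin 3 → Fin N := fun d => ⟨(((s : ℤ) + ((d : ℕ) : ℤ) - 1) % (N : ℤ)).toNat, by
    have h0 : 0 ≤ ((s : ℤ) + ((d : ℕ) : ℤ) - 1) % (N : ℤ) := Int.emod_nonneg _ (by exact_mod_cast hNpos.ne')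
    have h1 : ((s : ℤ) + ((d : ℕ) : ℤ) - 1) % (N : ℤ) < N := Int.emod_lt_of_pos _ (by exact_mod_cast hNpos)
    omega⟩ with hf
  have hsub : (Finset.univ : Finset (Fin N)).filter (fun ω : Fin N => sectorWeightCirc n ((ω : ℕ) : ℤ) θ ≠ 0) ⊆
      Finset.univ.image f := by
    intro ω hω
    rw [Finset.mem_filter] at hω
    obtain ⟨d, hd, hdiv⟩ := sectorIndex_near_of_sectorWeightCirc_ne_zero hω.2
    rw [Finset.mem_image]
    -- `ω ≡ s - d (mod N)`, and `s - d = s + d' - 1` with `d' = 1 - d ∈ {0,1,2}`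
    have hd' : 0 ≤ 1 - d ∧ 1 - d ≤ 2 := by rw [abs_le] at hd; omega
    refine ⟨⟨(1 - d).toNat, by omega⟩, Finset.mem_univ _, ?_⟩
    apply Fin.ext
    simp only [hf]
    have hωlt : ((ω : ℕ) : ℤ) < N := by exact_mod_cast ω.isLt
    have hω0 : 0 ≤ ((ω : ℕ) : ℤ) := by positivity
    have hcast : (((1 - d).toNat : ℕ) : ℤ) = 1 - d := Int.toNat_of_nonneg hd'.1
    have hmod : ((s : ℤ) + (((1 - d).toNat : ℕ) : ℤ) - 1) % (N : ℤ) = ((ω : ℕ) : ℤ) := by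
      rw [hcast]
      obtain ⟨q, hq⟩ := hdiv
      have e : (s : ℤ) + (1 - d) - 1 = ((ω : ℕ) : ℤ) + q * (N : ℤ) := by
        have : (sectorIndex n θ : ℤ) = (s : ℤ) := by rw [hs]
        linarith
      rw [e, Int.add_mul_emod_self_right, Int.emod_eq_of_lt hω0 hωlt]
    have : ((((s : ℤ) + (((1 - d).toNat : ℕ) : ℤ) - 1) % (N : ℤ)).toNat : ℕ) = (ω : ℕ) := by
      rw [hmod]; simp
    exact this
  calc _ ≤ (Finset.univ.image f).card := Finset.card_le_card hsub
    _ ≤ (Finset.univ : Finset (Fin 3)).card := Finset.card_image_le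
    _ = 3 := by simp

end Summit.HubbardSuperconductivity.HubbardSuperconductivity.Theorems.PerturbedFermiCurve

end
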